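import Mathlib.LinearAlgebra.Matrix.Charpoly.Eigs
import Mathlib.LinearAlgebra.Matrix.PosDef
import Mathlib.LinearAlgebra.Matrix.ToLinearEquiv
import Mathlib.Analysis.Complex.Basic
import Literature.NumberTheory.Automorphic.UnitaryGroupArchimedeanPlaces                    -- ★ `UnitaryGroup.archLocal E N J w` (`U(σ_w J)(ℂ) ≤ GL_N(ℂ)`), `mem_archLocal_iff_conjTranspose` (`gᴴ σ_w(J) g = σ_w(J)`)
import HarnessLib

/-!
# R90-TF ∕ S2 «Ch11-arch» — THE F-C3 MATRIX LAYER: elliptic ∕ regular semisimple ∕ regular non-elliptic matrices over `ℂ` (topology-free), and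
# «on a compact `U(N)_τ` every element is elliptic»

Cell `hodgecm-mathlib`, programme R90-TF, section S2 (dealer K2E1b-plan (g7), DEAL «S2-F-C3» 2026-09-04T22:07:21Z — the F-C3 matrix layer of the S2-R16 (A)
architecture, R90-C11-audit1 (g0) PRE-FLAG F-C3 «`IsEllipticAt` becomes the topology-free eigenvalue form: every root of the charpoly of `g_τ` has norm 1»);
pen K2E3-p23 (g7) (`--kind definition --supports stmt-HodgeConjecture-24833 --as helper`); crux H413 = `stmt-HodgeConjecture-24833` (supports-only, closes nothing).
Used by the successor's `IsLocCuspidal` ∕ `IsCuspidalAt` (S2-R13, holes D-S2-9∕10∕11).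

CONTENT (self-contained linear algebra; no `instance`, no `notation`, no `sorry`).
* §1 `IsEllipticMat g : Prop := ∀ z ∈ g.charpoly.roots, ‖z‖ = 1` («every eigenvalue on the unit circle» — TOPOLOGY-FREE, F-C3); `IsRegSemisimpleMat g :=
  g.charpoly.Separable` (distinct eigenvalues); `IsRegNonEllipticMat g := IsRegSemisimpleMat g ∧ ¬ IsEllipticMat g`; the three `_iff` (`Iff.rfl`).
* §2 PROVED **`isEllipticMat_of_posDef (hJ : J.PosDef) (hg : gᴴ * J * g = J) : IsEllipticMat g`** — a root `z` of `charpoly g` is an eigenvalue: `det (z − g) = 0`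
  (★ Mathlib `Matrix.eval_charpoly`) gives `v ≠ 0` with `g v = z v` (★ `Matrix.exists_mulVec_eq_zero_iff`); the hermitian form `Q(v) = v† J v` is `g`-invariant
  (`(gv)† J (gv) = v† (gᴴ J g) v = Q(v)`, ★ `Matrix.star_mulVec`, `dotProduct_mulVec`, `mulVec_mulVec`) and scales by `z̄ z = ‖z‖²` on the eigenvector, while
  `Q(v) ≠ 0` (★ `Matrix.PosDef.dotProduct_mulVec_pos`, `ComplexOrder`) ⇒ `‖z‖² = 1` ⇒ `‖z‖ = 1`.  The relation is stated in the ORIENTATION OF RECORD of ★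
  `UnitaryGroup.archLocal` (`Literature/NumberTheory/Automorphic/UnitaryGroupArchimedeanPlaces.lean` :99, `unitaryGroupOfForm (starRingEnd ℂ) (J.map w.1.embedding)`;
  :110 `mem_archLocal_iff_conjTranspose : g ∈ archLocal E N J w ↔ gᴴ * J.map w.1.embedding * g = J.map w.1.embedding`).
* §3 COROLLARY **`isEllipticMat_archLocal_of_posDef (hJ : (J.map w.1.embedding).PosDef) (g : UnitaryGroup.archLocal E N J w) : IsEllipticMat (g : Matrix)`** =
  «on compact `U(N)_τ` (definite `σ_w(J)`) every element is elliptic» (F-C3 ∕ S2-R16 (A) read-back), and the `(-J)`-definite twin.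
* §4 NON-EMPTINESS WITNESS `exists_isRegNonEllipticMat_two`: for the antidiagonal (split, indefinite) form `J₂ = [[0,1],[1,0]]` the diagonal `g = diag(2, 1∕2)`
  satisfies `gᴴ J₂ g = J₂` and is regular non-elliptic (charpoly `(X − 2)(X − 1∕2)`, separable, root `2` off the unit circle) — so «elliptic» is a genuine
  restriction off the compact places.

HONEST LABEL: HC_CM is proved only modulo the 7 printed citations (2 remaining named inputs: hLiu418 = `stmt-HodgeConjecture-24832`, h413 =
`stmt-HodgeConjecture-24833`) until rung 0 closes; an eigenvalue lemma pays no socket — it is the matrix layer of the two-place binders; count-neutral.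
Default heartbeats.

References: [Rogawski1990] §3.1 p. 19 (regular, elliptic elements), §4.9; [PlatonovRapinchuk1994] §3.2 Thm. 3.1 (anisotropic at `∞` ⇔ compact);
[Knapp1986] Ch. I §1 (`U(n)` compact, eigenvalues of unitary matrices).
-/

set_option autoImplicit false
-- the mandated namespace repeats the single-problem summit's segment (`HodgeConjecture.HodgeConjecture`)
set_option linter.dupNamespace false

noncomputable section

open NumberField NumberField.InfinitePlace Polynomial
open scoped Matrix MatrixGroups ComplexConjugate ComplexOrder

namespace Summit.HodgeConjecture.HodgeConjecture.R90.S2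

open Literature.NumberTheory.Automorphic

/-! ## §1 The three matrix predicates (topology-free) [§3.1 p. 19] -/

/-- **`IsEllipticMat g`** — every eigenvalue of the complex `N × N` matrix `g` (every root of its characteristic polynomial, with multiplicity irrelevant) lies on
the unit circle: `‖z‖ = 1`.  TOPOLOGY-FREE form of «`g` lies in a compact subgroup ∕ is elliptic at the archimedean place» for semisimple `g` (F-C3).
[cite: Rogawski1990, §3.1 p. 19] [cite: Knapp1986, Ch. I §1] -/
def IsEllipticMat {N : ℕ} (g : Matrix (Fin N) (Fin N) ℂ) : Prop :=
  ∀ z ∈ g.charpoly.roots, ‖z‖ = 1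

/-- **`IsRegSemisimpleMat g`** — the characteristic polynomial of `g` is separable (no repeated root over `ℂ`): `g` has `N` distinct eigenvalues, i.e. `g` is
regular semisimple. [cite: Rogawski1990, §3.1 p. 19] -/
def IsRegSemisimpleMat {N : ℕ} (g : Matrix (Fin N) (Fin N) ℂ) : Prop :=
  g.charpoly.Separable

/-- **`IsRegNonEllipticMat g`** — `g` is regular semisimple and NOT elliptic (some eigenvalue off the unit circle): the test class of regular non-elliptic
elements at an archimedean place (F-C3; the `γ` at which a cuspidal-at-`∞` test function's orbital integrals are required to vanish).
[cite: Rogawski1990, §3.1 p. 19; §4.9] -/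
def IsRegNonEllipticMat {N : ℕ} (g : Matrix (Fin N) (Fin N) ℂ) : Prop :=
  IsRegSemisimpleMat g ∧ ¬ IsEllipticMat g

/-- Unfolding (`Iff.rfl`). [cite: Rogawski1990, §3.1 p. 19] -/
theorem isEllipticMat_iff {N : ℕ} (g : Matrix (Fin N) (Fin N) ℂ) : IsEllipticMat g ↔ ∀ z ∈ g.charpoly.roots, ‖z‖ = 1 := Iff.rfl

/-- Unfolding (`Iff.rfl`). [cite: Rogawski1990, §3.1 p. 19] -/
theorem isRegSemisimpleMat_iff {N : ℕ} (g : Matrix (Fin N) (Fin N) ℂ) : IsRegSemisimpleMat g ↔ g.charpoly.Separable := Iff.rfl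

/-- Unfolding (`Iff.rfl`). [cite: Rogawski1990, §3.1 p. 19; §4.9] -/
theorem isRegNonEllipticMat_iff {N : ℕ} (g : Matrix (Fin N) (Fin N) ℂ) :
    IsRegNonEllipticMat g ↔ IsRegSemisimpleMat g ∧ ¬ IsEllipticMat g := Iff.rfl

/-- Equivalent `IsRoot` form of ellipticity (★ `Polynomial.mem_roots`, `charpoly` is monic hence non-zero). [cite: Rogawski1990, §3.1 p. 19] -/
theorem isEllipticMat_iff_isRoot {N : ℕ} (g : Matrix (Fin N) (Fin N) ℂ) : IsEllipticMat g ↔ ∀ z, g.charpoly.IsRoot z → ‖z‖ = 1 := by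
  refine ⟨fun h z hz => h z ((Polynomial.mem_roots g.charpoly_monic.ne_zero).2 hz), fun h z hz => h z ((Polynomial.mem_roots g.charpoly_monic.ne_zero).1 hz)⟩

/-! ## §2 Eigenvalues of a `J`-unitary matrix for a definite hermitian `J` lie on the unit circle [Knapp1986 Ch. I §1; PlatonovRapinchuk1994 §3.2] -/

/-- **An eigenvector for every root of the characteristic polynomial**: `charpoly g (z) = det (z − g) = 0` (★ `Matrix.eval_charpoly`) gives `v ≠ 0` with `(z − g) v = 0`
(★ `Matrix.exists_mulVec_eq_zero_iff`), i.e. `g v = z • v`. [cite: Knapp1986, Ch. I §1] -/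
theorem exists_eigenvector_of_isRoot_charpoly {N : ℕ} (g : Matrix (Fin N) (Fin N) ℂ) {z : ℂ} (hz : g.charpoly.IsRoot z) :
    ∃ v : Fin N → ℂ, v ≠ 0 ∧ g *ᵥ v = z • v := by
  have hdet : (Matrix.scalar (Fin N) z - g).det = 0 := by
    rw [← Matrix.eval_charpoly]; exact hz
  obtain ⟨v, hv, hv0⟩ := Matrix.exists_mulVec_eq_zero_iff.2 hdet
  refine ⟨v, hv, ?_⟩
  rw [Matrix.sub_mulVec, sub_eq_zero] at hv0
  rw [← hv0]
  ext i
  simp [Matrix.scalar_apply, Matrix.mulVec_diagonal]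

/-- **The hermitian form `v ↦ v† J v` is invariant under a `J`-unitary `g`** (`gᴴ J g = J`): `(g v)† J (g v) = v† J v`
(★ `Matrix.star_mulVec`, `Matrix.dotProduct_mulVec`, `Matrix.mulVec_mulVec`). [cite: Knapp1986, Ch. I §1] -/
theorem star_mulVec_dotProduct_mulVec_of_conjTranspose_mul_mul {N : ℕ} {J g : Matrix (Fin N) (Fin N) ℂ} (hg : gᴴ * J * g = J) (v : Fin N → ℂ) :
    star (g *ᵥ v) ⬝ᵥ (J *ᵥ (g *ᵥ v)) = star v ⬝ᵥ (J *ᵥ v) := by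
  rw [Matrix.star_mulVec, ← Matrix.dotProduct_mulVec, Matrix.mulVec_mulVec, Matrix.mulVec_mulVec, hg]

/-- **F-C3 CORE — for a positive definite hermitian `J`, every eigenvalue of a `J`-unitary matrix lies on the unit circle**: `J.PosDef → gᴴ * J * g = J → IsEllipticMat g`
(relation in the orientation of record of ★ `UnitaryGroup.archLocal`, ★ `mem_archLocal_iff_conjTranspose`).  On an eigenvector `g v = z v`, `v ≠ 0`, the invariant
form scales by `z̄ z = ‖z‖²` while `v† J v > 0` (★ `Matrix.PosDef.dotProduct_mulVec_pos`), so `‖z‖² = 1`.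
[cite: Knapp1986, Ch. I §1] [cite: PlatonovRapinchuk1994, §3.2 Thm. 3.1] [cite: Rogawski1990, §3.1 p. 19] -/
theorem isEllipticMat_of_posDef {N : ℕ} {J g : Matrix (Fin N) (Fin N) ℂ} (hJ : J.PosDef) (hg : gᴴ * J * g = J) : IsEllipticMat g := by
  rw [isEllipticMat_iff_isRoot]
  intro z hz
  obtain ⟨v, hv, hgv⟩ := exists_eigenvector_of_isRoot_charpoly g hz
  have hQ : star v ⬝ᵥ (J *ᵥ v) ≠ 0 := (hJ.dotProduct_mulVec_pos hv).ne'
  have hinv := star_mulVec_dotProduct_mulVec_of_conjTranspose_mul_mul hg v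
  rw [hgv, star_smul, Matrix.mulVec_smul, smul_dotProduct, dotProduct_smul, smul_eq_mul, smul_eq_mul, ← mul_assoc] at hinv
  -- `hinv : star z * z * Q = Q`
  have hzz : star z * z = 1 := mul_right_cancel₀ hQ (hinv.trans (one_mul _).symm)
  have hsq : (‖z‖ : ℝ) ^ 2 = 1 := by
    have h := Complex.conj_mul' z
    rw [Complex.star_def] at hzz
    rw [hzz] at h
    exact_mod_cast h.symm
  nlinarith [norm_nonneg z]

/-- The `(-J)`-definite twin: `gᴴ J g = J` iff `gᴴ (−J) g = −J`, so a NEGATIVE definite `J` gives the same conclusion (★ `isCompact_archLocal_of_posDef` allows both signs).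
[cite: Knapp1986, Ch. I §1] [cite: PlatonovRapinchuk1994, §3.2 Thm. 3.1] -/
theorem isEllipticMat_of_neg_posDef {N : ℕ} {J g : Matrix (Fin N) (Fin N) ℂ} (hJ : (-J).PosDef) (hg : gᴴ * J * g = J) : IsEllipticMat g :=
  isEllipticMat_of_posDef hJ (by rw [Matrix.mul_neg, Matrix.neg_mul, hg])

/-! ## §3 «On a compact `U(N)_τ` every element is elliptic» (F-C3 ∕ S2-R16 (A) read-back) [PlatonovRapinchuk1994 §3.2 Thm. 3.1] -/

/-- **COMPACT PLACE ⇒ ELLIPTIC**: at a complex place `w` of `E` where `σ_w(J)` is POSITIVE DEFINITE (`U(J)_w = U(N)` compact, ★ `isCompact_archLocal_of_posDef`), every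
`g ∈ U(σ_w J)(ℂ) =` ★ `UnitaryGroup.archLocal E N J w` is an elliptic matrix — all its eigenvalues lie on the unit circle.
[cite: PlatonovRapinchuk1994, §3.2 Thm. 3.1] [cite: Knapp1986, Ch. I §1] [cite: Rogawski1990, §3.1 p. 19] -/
theorem isEllipticMat_archLocal_of_posDef (E : Type) [Field E] [NumberField E] (N : ℕ) (J : Matrix (Fin N) (Fin N) E)
    (w : {w : InfinitePlace E // IsComplex w}) (hJ : (J.map w.1.embedding).PosDef) (g : UnitaryGroup.archLocal E N J w) :
    IsEllipticMat (((g : GL (Fin N) ℂ)) : Matrix (Fin N) (Fin N) ℂ) :=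
  isEllipticMat_of_posDef hJ ((UnitaryGroup.mem_archLocal_iff_conjTranspose E N J w (g : GL (Fin N) ℂ)).1 g.2)

/-- The negative definite twin (`-σ_w(J)` positive definite — the other sign allowed by ★ `isCompact_archLocal_of_posDef`).
[cite: PlatonovRapinchuk1994, §3.2 Thm. 3.1] [cite: Knapp1986, Ch. I §1] -/
theorem isEllipticMat_archLocal_of_neg_posDef (E : Type) [Field E] [NumberField E] (N : ℕ) (J : Matrix (Fin N) (Fin N) E)
    (w : {w : InfinitePlace E // IsComplex w}) (hJ : (-J.map w.1.embedding).PosDef) (g : UnitaryGroup.archLocal E N J w) :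
    IsEllipticMat (((g : GL (Fin N) ℂ)) : Matrix (Fin N) (Fin N) ℂ) :=
  isEllipticMat_of_neg_posDef hJ ((UnitaryGroup.mem_archLocal_iff_conjTranspose E N J w (g : GL (Fin N) ℂ)).1 g.2)

/-- Hence NO element of a compact `U(σ_w J)(ℂ)` is regular non-elliptic: the F-C3 test class is EMPTY at the compact places (the vanishing condition of a
cuspidal-at-`w` function is vacuous there — it bites only at the non-compact place). [cite: PlatonovRapinchuk1994, §3.2 Thm. 3.1] [cite: Rogawski1990, §4.9] -/
theorem not_isRegNonEllipticMat_archLocal_of_posDef (E : Type) [Field E] [NumberField E] (N : ℕ) (J : Matrix (Fin N) (Fin N) E)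
    (w : {w : InfinitePlace E // IsComplex w}) (hJ : (J.map w.1.embedding).PosDef) (g : UnitaryGroup.archLocal E N J w) :
    ¬ IsRegNonEllipticMat (((g : GL (Fin N) ℂ)) : Matrix (Fin N) (Fin N) ℂ) :=
  fun h => h.2 (isEllipticMat_archLocal_of_posDef E N J w hJ g)

/-! ## §4 A regular non-elliptic witness for the split rank-2 form [§3.1 p. 19] -/

/-- **WITNESS**: for the antidiagonal form `J₂ = [[0,1],[1,0]]` (indefinite, signature `(1,1)`), `g = diag(2, 1∕2)` is `J₂`-unitary (`gᴴ J₂ g = J₂`) and REGULAR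
NON-ELLIPTIC: `charpoly g = (X − 2)(X − 1∕2)` is separable and has the root `2` off the unit circle. [cite: Rogawski1990, §3.1 p. 19; §4.9] -/
theorem exists_isRegNonEllipticMat_two :
    ∃ g : Matrix (Fin 2) (Fin 2) ℂ, gᴴ * !![(0 : ℂ), 1; 1, 0] * g = !![(0 : ℂ), 1; 1, 0] ∧ IsRegNonEllipticMat g := by
  have hchar : (Matrix.diagonal ![(2 : ℂ), 2⁻¹]).charpoly = (X - C 2) * (X - C 2⁻¹) := by
    rw [Matrix.charpoly_diagonal, Fin.prod_univ_two]
    simp only [Matrix.cons_val_zero, Matrix.cons_val_one]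
  refine ⟨Matrix.diagonal ![(2 : ℂ), 2⁻¹], ?_, ?_, ?_⟩
  · -- `gᴴ J₂ g = J₂`: `g` is real diagonal, `2̄ · 2⁻¹ = 1 = (2⁻¹)‾ · 2`
    ext i j
    fin_cases i <;> fin_cases j <;>
      simp [Matrix.mul_apply, Matrix.diagonal_apply, star_inv₀]
  · -- separable: `charpoly = (X − 2)(X − 2⁻¹)` with `2 − 2⁻¹ ≠ 0`
    rw [isRegSemisimpleMat_iff, hchar]
    have hne : (2 : ℂ) - 2⁻¹ ≠ 0 := by norm_num
    exact Polynomial.separable_X_sub_C.mul Polynomial.separable_X_sub_C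
      (Polynomial.isCoprime_X_sub_C_of_isUnit_sub (isUnit_iff_ne_zero.2 hne))
  · -- not elliptic: `2` is a root with `‖2‖ = 2 ≠ 1`
    rw [isEllipticMat_iff_isRoot]
    intro h
    have h2 : ‖(2 : ℂ)‖ = 1 := h 2 (by rw [hchar]; simp)
    norm_num at h2

end Summit.HodgeConjecture.HodgeConjecture.R90.S2

end
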